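import Mathlib
import HarnessLib

/-!
# Markman 2025 — LEMMA 9.3.8 (conjugation of the `HT²`-action by `exp(−λ)`), the `H¹(TM)` case AS PRINTED,
# kernel-checked as an identity for a derivation and a nilpotent class

E. Markman: [M] *Cycles on abelian 2n-folds of Weil type from secant sheaves on abelian n-folds*,
arXiv:2502.03415 **v2** (2025-06-08), bib `Markman2025SecantWeil` — UNREFEREED PREPRINT. «v2 p. N L m» = PyMuPDF
line `m` of PDF page `N` of the public arXiv PDF (sha256/16 `8155aa33870069b8`); the displays below were read BY EYE
at seat lit-w-markman (pub-hsemireg LIT-W, 2026-08-23; renders `r_mar25v2_p86_bottom.png`, `r_mar25v2_p87_top.png`).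

## What is printed (verbatim; `M := X × X̂`, `E` the reflexive secant^{⊠2}-sheaf of rank `r`, `B` its descent)

* [M] v2 (9.3.3), p. 86 L23–28: «Let `B` be a twisted sheaf as in Lemma 9.3.6. We have the equality (9.3.3)
  `q^*at_B = at_E − (c₁(E)/r)·id_E`, by Equation (7.3.5).»; p. 86 L34–38: «Consider the exponential Atiyah class
  `exp(at_B)` with graded summands `at_k(B)` in `Hom(B, B ⊗ Ω^k_Y[k])`. Note that `at₀(B)` is `r` times the unit
  section and `at₁(B) = at_B`. Note that `κ(B)` is the trace of `exp(at_B)` and `q^*κ(B) = ch(E) exp(−c₁(E)/r)`, by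
  equation (9.3.3).»
* [M] v2 (9.3.4), p. 86 L39–69 (display, by eye): «Set `M := X × X̂` and `λ := c₁(E)/r`. Let
  `⌟exp(λ) : H¹(TM) → HT²(M)` be the composition (9.3.4)
  `H¹(TM) ⊂→ H²(O_M) ⊕ H¹(TM) ⊕ H⁰(∧²TM) —[⌟ (1 λ λ²/2 ; 0 1 λ ; 0 0 1)]→ H²(O_M) ⊕ H¹(TM) ⊕ H⁰(∧²TM)`
  which has image in `H²(O_M) ⊕ H¹(TM)`.»
* LEMMA 9.3.8 ([M] v2 p. 86 L70–84, by eye): «The following diagram is commutative [square: `HT²(M) → End(HΩ^*(M))`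
  on top and bottom, left vertical arrow `⌟exp(λ)`, right vertical arrow `Ad_{exp(−λ)}`;
  `ζ ↦ exp(−λ) ∪ [ζ ∘ (exp(λ) ∪ (•))]`] where the horizontal arrows are defined via the `HT^*(M)`-module structure
  of `HΩ^*(M)` and the right vertical arrow is the conjugation by cup product with `exp(−λ)`.»  PROOF (p. 86 L85 –
  p. 87 L21, by eye): «An element `ζ ∈ H²(O_M) ⊂ HT²(M)` is mapped to itself by `⌟λ` and similarly, its action on
  `HΩ^*(M)` commutes with cup product with `exp(−λ)` and so it is mapped to itself by `Ad_{exp(−λ)}`. Given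
  `ζ ∈ H¹(TM)` and `γ ∈ HΩ^*(M)` we have
  `(Ad_{exp(−λ)}(ζ))(γ) = exp(−λ) ∪ {ζ⌟(exp(λ) ∪ γ)} = exp(−λ) ∪ {ζ⌟[γ + λ ∪ γ + (λ²/2) ∪ γ + (λ³/3!) ∪ γ ⋯]}`
  `= exp(−λ) ∪ {exp(λ) ∪ (ζ⌟γ) + exp(λ) ∪ (ζ⌟λ) ∪ γ} = (ζ⌟λ) ∪ γ + (ζ⌟γ)`.
  The proof for `ζ ∈ H⁰(∧²TM)` is similar.»  (Used in LEMMA 9.3.9 / diagram (9.3.5), p. 87 L92 – p. 88 L12: «If the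
  class `λ` is the first Chern class of a line bundle `L`, then the right arrow in (9.3.4) is the action of the
  derived equivalence of tensorization by `L` on `HT²(M)`, by Lemma 9.3.8.»)

## The model and what this file proves (NO named fact; nothing geometric)
Contraction with a class `ζ ∈ H¹(TM)` is an EVEN derivation of the cup-product algebra `HΩ^*(M) = ⊕ H^q(Ω^p_M)`
(bidegree `(−1, +1)`, total degree `0`), and `λ = c₁(E)/r ∈ H¹(Ω¹_M)` is nilpotent of even total degree, hence
central; `exp(λ)` is the finite exponential series. MODEL: a commutative `ℚ`-algebra `A` (standing for `HΩ^*(M)`, or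
for its even-total-degree part, which contains `λ`, `exp(±λ)` and is preserved by `ζ⌟`), a derivation
`D : Derivation ℚ A A` standing for `ζ⌟`, a nilpotent `l ∈ A` standing for `λ`, and Mathlib's `IsNilpotent.exp`.
PROVED: (1) `D(exp l) = exp(l)·D(l)` — the step «`ζ⌟[γ + λ∪γ + (λ²/2)∪γ + ⋯] = exp(λ)∪(ζ⌟γ) + exp(λ)∪(ζ⌟λ)∪γ`»
(Leibniz on each `λ^k/k!`; the series is finite because `l` is nilpotent); (2) the displayed identity
`exp(−l)·D(exp(l)·γ) = D(l)·γ + D(γ)` for every `γ` — i.e. `Ad_{exp(−λ)}(ζ⌟) = (ζ⌟λ)∪ + ζ⌟`, the `H¹(TM)`-column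
`(λ, 1, 0)ᵀ` of the matrix in (9.3.4); (3) the `H²(O_M)` case «mapped to itself»: multiplication operators commute
with `Ad_{exp(−λ)}`; (4) the algebra behind «`q^*κ(B) = ch(E) exp(−c₁(E)/r)` by (9.3.3)»: in ANY `ℚ`-algebra, for
a nilpotent `a` (standing for `at_E`) commuting with a nilpotent `c` (standing for `λ·id_E`),
`exp(a − c) = exp(−c)·exp(a)` (Mathlib `IsNilpotent.exp_add_of_commute`) — taking traces is not modelled.
NOT covered in this first part: the `H⁰(∧²TM)` case («similar» in print: a second-order operator, column
`(λ²/2, λ, 1)ᵀ`) — it is kernel-checked in OPERATOR form in the Appendix at the end of this file (truncated Hadamard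
series `exp(−L)·P·exp(L) = P + [P, L] + ½[[P, L], L]` when the third commutator vanishes) —, Koszul signs for odd `γ`
(none arise in print either, `ζ⌟` being even), and everything about `M`, `E`, `B`, `q`.
Bookkeeping for the pub-hsemireg LIT-W table row M-Mk6 (the descent diagram (9.3.5) behind LEMMA 9.3.11) and for
the W1-tw seats' «`at_E − λ·id`» twist; it says nothing about semiregularity or the Hodge conjecture and re-proves
no theorem of [M].
-/

namespace Literature.AlgebraicGeometry.Markman2025

namespace ContractionExp

open Finset
open scoped Nat

variable {A : Type*} [CommRing A] [Algebra ℚ A]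

/-- **[M] v2 p. 87 L4–17, the middle step of the display in the proof of LEMMA 9.3.8**
«`ζ⌟[γ + λ ∪ γ + (λ²/2) ∪ γ + (λ³/3!) ∪ γ ⋯] = exp(λ) ∪ (ζ⌟γ) + exp(λ) ∪ (ζ⌟λ) ∪ γ`» rests on
`ζ⌟exp(λ) = exp(λ) ∪ (ζ⌟λ)`: in the model, for a derivation `D` and a nilpotent `l`, `D(exp l) = exp(l)·D(l)`
(term by term: `D(l^k/k!) = (l^{k−1}/(k−1)!)·D l`; writing `exp(l) = Σ_{k ≤ N} l^k/k!` with `l^N = 0` on the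
left and `Σ_{k < N}` on the right makes the index shift exact, so the finite sums close up).
[cite: Markman2025SecantWeil, proof of Lemma 9.3.8, v2 p. 87 L4–17] -/
theorem apply_exp (D : Derivation ℚ A A) {l : A} (hl : IsNilpotent l) :
    D (IsNilpotent.exp l) = IsNilpotent.exp l * D l := by
  obtain ⟨N, hN⟩ := hl
  have hN1 : l ^ (N + 1) = 0 := by rw [pow_succ, hN, zero_mul]
  rw [show IsNilpotent.exp l * D l = (∑ i ∈ range N, ((i ! : ℚ)⁻¹ • l ^ i)) * D l by
    rw [IsNilpotent.exp_eq_sum hN]]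
  rw [IsNilpotent.exp_eq_sum hN1, map_sum, Finset.sum_range_succ', Finset.sum_mul]
  have h0 : D (((0 ! : ℕ) : ℚ)⁻¹ • l ^ 0) = 0 := by simp
  rw [h0, add_zero]
  refine Finset.sum_congr rfl fun i _ => ?_
  rw [D.map_smul, D.leibniz_pow, Nat.add_sub_cancel, smul_eq_mul, smul_mul_assoc,
    ← Nat.cast_smul_eq_nsmul ℚ (i + 1), smul_smul, Nat.factorial_succ]
  congr 1
  push_cast
  field_simp

/-- **[M] LEMMA 9.3.8, the `H¹(TM)` case as displayed (v2 p. 87 L3–19)**: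
«`(Ad_{exp(−λ)}(ζ))(γ) = exp(−λ) ∪ {ζ⌟(exp(λ) ∪ γ)} = ⋯ = exp(−λ) ∪ {exp(λ) ∪ (ζ⌟γ) + exp(λ) ∪ (ζ⌟λ) ∪ γ}
= (ζ⌟λ) ∪ γ + (ζ⌟γ)`»: in the model, `exp(−l)·D(exp(l)·γ) = D(l)·γ + D(γ)` for every `γ` — conjugation by
`exp(−λ)` turns `ζ⌟` into `ζ⌟ + (ζ⌟λ)∪`, the `H¹(TM)`-column `(λ, 1, 0)ᵀ` of the matrix `⌟exp(λ)` in (9.3.4)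
(p. 86 L39–69: «which has image in `H²(O_M) ⊕ H¹(TM)`»).
[cite: Markman2025SecantWeil, Lemma 9.3.8, v2 p. 86 L70–84 and proof p. 87 L3–19] -/
theorem ad_exp_neg_apply (D : Derivation ℚ A A) {l : A} (hl : IsNilpotent l) (γ : A) :
    IsNilpotent.exp (-l) * D (IsNilpotent.exp l * γ) = D l * γ + D γ := by
  rw [D.leibniz, apply_exp D hl, smul_eq_mul, smul_eq_mul]
  have h := IsNilpotent.exp_neg_mul_exp_self hl
  calc IsNilpotent.exp (-l) * (IsNilpotent.exp l * D γ + γ * (IsNilpotent.exp l * D l))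
      = (IsNilpotent.exp (-l) * IsNilpotent.exp l) * (D l * γ + D γ) := by ring
    _ = D l * γ + D γ := by rw [h, one_mul]

/-- **[M] proof of LEMMA 9.3.8, first sentence (v2 p. 86 L85 – p. 87 L3)** «An element `ζ ∈ H²(O_M) ⊂ HT²(M)` is
mapped to itself by `⌟λ` and similarly, its action on `HΩ^*(M)` commutes with cup product with `exp(−λ)` and so it
is mapped to itself by `Ad_{exp(−λ)}`»: in the model the action of `ζ ∈ H²(O_M)` is multiplication by an element
`z`, and `exp(−l)·(z·(exp(l)·γ)) = z·γ` — the `H²(O_M)`-column `(1, 0, 0)ᵀ` of (9.3.4).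
[cite: Markman2025SecantWeil, proof of Lemma 9.3.8, v2 p. 86 L85 – p. 87 L3] -/
theorem ad_exp_neg_mul_left (z : A) {l : A} (hl : IsNilpotent l) (γ : A) :
    IsNilpotent.exp (-l) * (z * (IsNilpotent.exp l * γ)) = z * γ := by
  have h := IsNilpotent.exp_neg_mul_exp_self hl
  calc IsNilpotent.exp (-l) * (z * (IsNilpotent.exp l * γ))
      = (IsNilpotent.exp (-l) * IsNilpotent.exp l) * (z * γ) := by ring
    _ = z * γ := by rw [h, one_mul]

end ContractionExp

namespace ContractionExp

/-- **[M] v2 p. 86 L37–38 with (9.3.3)** «Note that `κ(B)` is the trace of `exp(at_B)` and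
`q^*κ(B) = ch(E) exp(−c₁(E)/r)`, by equation (9.3.3)» ((9.3.3): «`q^*at_B = at_E − (c₁(E)/r)·id_E`»): the algebra
is `exp(a − c) = exp(−c)·exp(a)` for a nilpotent `a` (standing for `at_E` in the Yoneda algebra) COMMUTING with a
nilpotent `c` (standing for the central element `λ·id_E`), in any `ℚ`-algebra — Mathlib's
`IsNilpotent.exp_add_of_commute`; the trace `tr(exp(−λ·id)·exp(at_E)) = exp(−λ) ∪ ch(E)` is not modelled.
[cite: Markman2025SecantWeil, (9.3.3) and p. 86 L34–38, v2 p. 86 L23–38] -/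
theorem exp_sub_of_commute {R : Type*} [Ring R] [Algebra ℚ R] {a c : R} (hac : Commute a c)
    (ha : IsNilpotent a) (hc : IsNilpotent c) :
    IsNilpotent.exp (a - c) = IsNilpotent.exp (-c) * IsNilpotent.exp a ∧
    IsNilpotent.exp (a - c) = IsNilpotent.exp a * IsNilpotent.exp (-c) := by
  have h1 : IsNilpotent.exp (a + -c) = IsNilpotent.exp a * IsNilpotent.exp (-c) :=
    IsNilpotent.exp_add_of_commute hac.neg_right ha hc.neg
  have h2 : IsNilpotent.exp (-c + a) = IsNilpotent.exp (-c) * IsNilpotent.exp a :=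
    IsNilpotent.exp_add_of_commute hac.neg_right.symm hc.neg ha
  refine ⟨?_, ?_⟩
  · rw [sub_eq_neg_add, h2]
  · rw [sub_eq_add_neg, h1]

end ContractionExp

/-! ## Appendix (lit-w-markman g13, 2026-08-23): the `H⁰(∧²TM)` case of LEMMA 9.3.8 — «The proof for
`ζ ∈ H⁰(∧²TM)` is similar» (v2 p. 87 L20–21) — and the FULL matrix of (9.3.4), in OPERATOR form

For `ζ ∈ H⁰(∧²TM)` contraction `ζ⌟` is a SECOND-ORDER operator on `HΩ^*(M)` (not a derivation), and the third column
`(λ²/2, λ, 1)ᵀ` of the matrix `⌟exp(λ)` in (9.3.4) says `Ad_{exp(−λ)}(ζ⌟) = (ζ⌟(λ²/2))∪ + (ζ⌟λ)⌟ + ζ⌟`.  MODEL: a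
`ℚ`-algebra `R` (standing for `End(HΩ^*(M))`), `P ∈ R` for the operator `ζ⌟`, a nilpotent `L ∈ R` for cup product
with `λ`, `D₁ := [P, L] = P L − L P` (standing for `(ζ⌟λ)⌟`) and `D₂ := [D₁, L]` (standing for cup product with
`(ζ⌟λ)⌟λ = 2·ζ⌟(λ²/2)`), under the single hypothesis that `D₂` commutes with `L` (third commutator zero — the operator
shadow of «`ζ⌟` has order two»).  PROVED: `P·Lⁿ⁺² = Lⁿ⁺²·P + (n+2)·Lⁿ⁺¹·D₁ + C(n+2, 2)·Lⁿ·D₂` (`mul_pow_second_order`),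
`P·exp(L) = exp(L)·(P + D₁ + ½D₂)` (`mul_exp_second_order`) and the conjugation form
`exp(−L)·P·exp(L) = P + D₁ + ½D₂` (`ad_exp_neg_second_order`) — the truncated Hadamard series; with `D₂ = 0` it is the
`H¹(TM)` column `(λ, 1, 0)ᵀ` again (`ad_exp_neg_first_order`, the operator form of `ContractionExp.ad_exp_neg_apply`).
The dictionary `D₁ ↔ (ζ⌟λ)⌟`, `½D₂ ↔ (ζ⌟(λ²/2))∪` (Koszul signs included) is the READING of the model, not proved here;
nothing geometric is asserted. [cite: Markman2025SecantWeil, Lemma 9.3.8 and (9.3.4), v2 p. 86 L39–84, proof p. 87 L3–21]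
-/

namespace ContractionExp

open Finset
open scoped Nat

variable {R : Type*} [Ring R]

/-- **Commutator bookkeeping behind the third column of (9.3.4)**: if `P L = L P + D₁`, `D₁ L = L D₁ + D₂` and
`D₂ L = L D₂`, then `P·Lⁿ⁺² = Lⁿ⁺²·P + (n+2)·Lⁿ⁺¹·D₁ + C(n+2, 2)·Lⁿ·D₂` for every `n`
(and trivially `P·L⁰ = P`, `P·L¹ = L·P + D₁`). [cite: Markman2025SecantWeil, proof of Lemma 9.3.8 («The proof for
ζ ∈ H⁰(∧²TM) is similar»), v2 p. 87 L3–21] -/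
theorem mul_pow_second_order (P L D₁ D₂ : R) (h1 : P * L = L * P + D₁) (h2 : D₁ * L = L * D₁ + D₂)
    (h3 : D₂ * L = L * D₂) (n : ℕ) :
    P * L ^ (n + 2) = L ^ (n + 2) * P + (n + 2) • (L ^ (n + 1) * D₁) + ((n + 2).choose 2) • (L ^ n * D₂) := by
  induction n with
  | zero =>
    show P * L ^ 2 = L ^ 2 * P + 2 • (L ^ 1 * D₁) + (Nat.choose 2 2) • (L ^ 0 * D₂)
    rw [Nat.choose_self, one_smul, pow_one, pow_zero, one_mul]
    calc P * L ^ 2 = (L * P + D₁) * L := by rw [pow_two, ← mul_assoc, h1]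
      _ = L * (L * P + D₁) + (L * D₁ + D₂) := by rw [add_mul, mul_assoc, h1, h2]
      _ = L ^ 2 * P + 2 • (L * D₁) + D₂ := by rw [pow_two, two_smul, mul_add, ← mul_assoc]; abel
  | succ n ih =>
    have eL : P * L ^ (n + 1 + 2) = P * L ^ (n + 2) * L := by
      rw [show n + 1 + 2 = (n + 2) + 1 from rfl, pow_succ, mul_assoc]
    have eP : L ^ (n + 2) * (L * P) = L ^ (n + 1 + 2) * P := by rw [← mul_assoc, ← pow_succ]
    have eD₁ : L ^ (n + 1) * (L * D₁) = L ^ (n + 1 + 1) * D₁ := by rw [← mul_assoc, ← pow_succ]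
    have eD₂ : L ^ n * (L * D₂) = L ^ (n + 1) * D₂ := by rw [← mul_assoc, ← pow_succ]
    have hc : (n + 1 + 2).choose 2 = (n + 2) + (n + 2).choose 2 := by
      rw [show n + 1 + 2 = (n + 2) + 1 from rfl, Nat.choose_succ_succ, Nat.choose_one_right]
    rw [eL, ih, add_mul, add_mul, smul_mul_assoc, smul_mul_assoc, mul_assoc _ P L, h1, mul_assoc _ D₁ L, h2,
      mul_assoc _ D₂ L, h3]
    simp only [mul_add, eP, eD₁, eD₂, hc, add_smul, smul_add, one_smul]
    abel

variable [Algebra ℚ R]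

/-- **`P·exp(L) = exp(L)·(P + [P, L] + ½[[P, L], L])`** for a nilpotent `L` whose third commutator with `P`
vanishes — the finite Hadamard series; termwise `C(n+2, 2)/(n+2)! = ½·1/n!` and `(n+2)/(n+2)! = 1/(n+1)!`.
[cite: Markman2025SecantWeil, proof of Lemma 9.3.8, v2 p. 87 L3–21] -/
theorem mul_exp_second_order (P L D₁ D₂ : R) (h1 : P * L = L * P + D₁) (h2 : D₁ * L = L * D₁ + D₂)
    (h3 : D₂ * L = L * D₂) (hL : IsNilpotent L) :
    P * IsNilpotent.exp L = IsNilpotent.exp L * (P + D₁ + (1 / 2 : ℚ) • D₂) := by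
  obtain ⟨N, hN⟩ := hL
  have hN1 : L ^ (N + 1) = 0 := by rw [pow_succ, hN, zero_mul]
  have hN2 : L ^ (N + 2) = 0 := by rw [pow_succ, hN1, zero_mul]
  -- the four finite exponential sums, peeled so that all run over `range N`
  have lhs : P * IsNilpotent.exp L =
      (∑ i ∈ range N, ((i + 1 + 1) ! : ℚ)⁻¹ • (P * L ^ (i + 1 + 1))) + P * L + P := by
    rw [IsNilpotent.exp_eq_sum hN2, Finset.mul_sum, Finset.sum_range_succ', Finset.sum_range_succ']
    simp only [mul_smul_comm, pow_zero, pow_one, zero_add, Nat.factorial_zero, Nat.factorial_one, Nat.cast_one,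
      inv_one, one_smul, mul_one]
  have eP : IsNilpotent.exp L * P =
      (∑ i ∈ range N, ((i + 1 + 1) ! : ℚ)⁻¹ • (L ^ (i + 1 + 1) * P)) + L * P + P := by
    rw [IsNilpotent.exp_eq_sum hN2, Finset.sum_mul, Finset.sum_range_succ', Finset.sum_range_succ']
    simp only [smul_mul_assoc, pow_zero, pow_one, zero_add, Nat.factorial_zero, Nat.factorial_one, Nat.cast_one,
      inv_one, one_smul, one_mul]
  have eD₁ : IsNilpotent.exp L * D₁ = (∑ i ∈ range N, ((i + 1) ! : ℚ)⁻¹ • (L ^ (i + 1) * D₁)) + D₁ := by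
    rw [IsNilpotent.exp_eq_sum hN1, Finset.sum_mul, Finset.sum_range_succ']
    simp only [smul_mul_assoc, pow_zero, Nat.factorial_zero, Nat.cast_one, inv_one, one_smul, one_mul]
  have eD₂ : (1 / 2 : ℚ) • (IsNilpotent.exp L * D₂) =
      ∑ i ∈ range N, ((1 / 2 : ℚ) * (i ! : ℚ)⁻¹) • (L ^ i * D₂) := by
    rw [IsNilpotent.exp_eq_sum hN, Finset.sum_mul, Finset.smul_sum]
    refine Finset.sum_congr rfl fun i _ => ?_
    rw [smul_mul_assoc, smul_smul]
  -- termwise identity inside `range N`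
  have key : ∀ i ∈ range N, ((i + 1 + 1) ! : ℚ)⁻¹ • (P * L ^ (i + 1 + 1)) =
      ((i + 1 + 1) ! : ℚ)⁻¹ • (L ^ (i + 1 + 1) * P) + ((i + 1) ! : ℚ)⁻¹ • (L ^ (i + 1) * D₁) +
        ((1 / 2 : ℚ) * (i ! : ℚ)⁻¹) • (L ^ i * D₂) := by
    intro i _
    have c1 : ((i + 2) ! : ℚ)⁻¹ * ((i + 2 : ℕ) : ℚ) = ((i + 1) ! : ℚ)⁻¹ := by
      rw [show i + 2 = i + 1 + 1 from rfl, Nat.factorial_succ (i + 1)]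
      push_cast
      field_simp
    have c2 : ((i + 2) ! : ℚ)⁻¹ * (((i + 2).choose 2 : ℕ) : ℚ) = (1 / 2 : ℚ) * (i ! : ℚ)⁻¹ := by
      rw [Nat.cast_choose_two ℚ (i + 2), show i + 2 = i + 1 + 1 from rfl, Nat.factorial_succ (i + 1),
        Nat.factorial_succ i]
      push_cast
      field_simp
      ring
    rw [show i + 1 + 1 = i + 2 from rfl, mul_pow_second_order P L D₁ D₂ h1 h2 h3 i, smul_add, smul_add,
      ← Nat.cast_smul_eq_nsmul ℚ (i + 2), ← Nat.cast_smul_eq_nsmul ℚ ((i + 2).choose 2)]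
    simp only [smul_smul]
    rw [c1, c2]
  rw [mul_add, mul_add, mul_smul_comm, lhs, eP, eD₁, eD₂, Finset.sum_congr rfl key, Finset.sum_add_distrib,
    Finset.sum_add_distrib, h1]
  abel

/-- **LEMMA 9.3.8, the `H⁰(∧²TM)` case in operator form — the third column `(λ²/2, λ, 1)ᵀ` of (9.3.4)**:
`exp(−L)·P·exp(L) = P + [P, L] + ½[[P, L], L]` for `P`, `L` as above («`Ad_{exp(−λ)}(ζ⌟) = (ζ⌟(λ²/2))∪ + (ζ⌟λ)⌟
+ ζ⌟`» in the model's reading). [cite: Markman2025SecantWeil, Lemma 9.3.8 and (9.3.4), v2 p. 86 L39–84, proof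
p. 87 L3–21] -/
theorem ad_exp_neg_second_order (P L D₁ D₂ : R) (h1 : P * L = L * P + D₁) (h2 : D₁ * L = L * D₁ + D₂)
    (h3 : D₂ * L = L * D₂) (hL : IsNilpotent L) :
    IsNilpotent.exp (-L) * P * IsNilpotent.exp L = P + D₁ + (1 / 2 : ℚ) • D₂ := by
  rw [mul_assoc, mul_exp_second_order P L D₁ D₂ h1 h2 h3 hL, ← mul_assoc, IsNilpotent.exp_neg_mul_exp_self hL,
    one_mul]

/-- The `H¹(TM)` column `(λ, 1, 0)ᵀ` of (9.3.4) in the same operator form (second commutator zero):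
`exp(−L)·P·exp(L) = P + [P, L]` — the operator shadow of `ContractionExp.ad_exp_neg_apply`.
[cite: Markman2025SecantWeil, Lemma 9.3.8 and (9.3.4), v2 p. 86 L39–84, proof p. 87 L3–19] -/
theorem ad_exp_neg_first_order (P L D₁ : R) (h1 : P * L = L * P + D₁) (h2 : D₁ * L = L * D₁)
    (hL : IsNilpotent L) : IsNilpotent.exp (-L) * P * IsNilpotent.exp L = P + D₁ := by
  have h := ad_exp_neg_second_order P L D₁ 0 h1 (by rw [h2, add_zero]) (by rw [zero_mul, mul_zero]) hL
  rwa [smul_zero, add_zero] at h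

end ContractionExp

end Literature.AlgebraicGeometry.Markman2025
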